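import Mathlib.InformationTheory.KullbackLeibler.Basic
import Literature.MathematicalPhysics.KineticTheory.HardSphereEulerProofs
import Literature.Analysis.FluidPDE.HardSphereDynamicsProofs
import Literature.Analysis.FunctionSpaces.TorusCalculusProofs
import HarnessLib

/-!
# Stub `stub_ledger` of the line `IdeatorTwoSketch` (crux `MacroClosure`), part 3: calculus tools

Support file (`--supports stmt-AtomisticToContinuum-14870`) for the registered stub
`stub_ledger : LedgerIdentity`; it collects the two analytic tools of the log-partition calculus
(conjunct (L2)):

* `hasDerivWithinAt_integral_of_dominated_convex` — differentiation under the integral sign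
  WITHIN a convex time set (one-sided at endpoints) with an integrable dominating function for the
  time derivatives; adapted from `Torus.hasDerivWithinAt_integral_of_convex`
  (`Literature/Analysis/FunctionSpaces/TorusCalculusProofs.lean`: finite measure, constant bound)
  — Mathlib's `hasDerivAt_integral_of_dominated_loc_of_deriv_le` is two-sided only;
* uniform bounds and continuity of jointly smooth space–time fields `φ : ℝ → 𝕋ᵈ → F` on a compact
  time set `S` (`Torus.IsSmoothSpaceTimeOn S φ`): `sup_{S × 𝕋ᵈ} ‖φ‖ < ∞`,
  `sup_{S × 𝕋ᵈ} ‖∂ₜφ‖ < ∞` (`∂ₜ = Torus.timeDerivWithin S`, for `S` of unique differentiability),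
  continuity of `s ↦ ∂ₜφ(s, x)` and of `s ↦ φ(s, x)` on `S` — all from continuity of the space–time
  lift and of its `fderivWithin` on `S × [0,1]ᵈ` (compact fundamental domain).
-/

noncomputable section

open MeasureTheory Filter Set Topology
open scoped ENNReal ContDiff

namespace Summit.AtomisticToContinuum.HydrodynamicLimit.Theorems.MacroClosureLine

open Literature.Analysis.FunctionSpaces

namespace StubLedger

/-! ## Differentiation under the integral sign within a convex time set, dominated version -/

-- adapted from Literature/Analysis/FunctionSpaces/TorusCalculusProofs.lean
-- (`Torus.hasDerivWithinAt_integral_of_convex`: there the measure is finite and the bound constant)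
/-- Differentiation under the integral sign, one-sided version with an integrable dominating
function: if `s ↦ F s x` is differentiable within the convex time set `S` with derivative
`F' s x`, `‖F' s x‖ ≤ bound x` on `S` with `bound` integrable, and the slices are integrable,
then `s ↦ ∫ F s x dμ` has derivative `∫ F' t x dμ` within `S` at `t ∈ S` (mean value inequality
along time segments in `S`, dominated convergence for the difference quotients). [folklore] -/
theorem hasDerivWithinAt_integral_of_dominated_convex {X : Type*} [MeasurableSpace X]
    {μ : Measure X} {E : Type*} [NormedAddCommGroup E] [NormedSpace ℝ E]
    {S : Set ℝ} (hS : Convex ℝ S) {t : ℝ} (ht : t ∈ S)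
    {F F' : ℝ → X → E} (hF_int : ∀ s ∈ S, Integrable (F s) μ)
    (hderiv : ∀ s ∈ S, ∀ x, HasDerivWithinAt (F · x) (F' s x) S s) {bound : X → ℝ}
    (hbound : ∀ s ∈ S, ∀ x, ‖F' s x‖ ≤ bound x) (hbound_int : Integrable bound μ)
    (hF'_meas : AEStronglyMeasurable (F' t) μ) :
    HasDerivWithinAt (fun s => ∫ x, F s x ∂μ) (∫ x, F' t x ∂μ) S t := by
  rw [hasDerivWithinAt_iff_tendsto_slope]
  have hmem : ∀ᶠ s in 𝓝[S \ {t}] t, s ∈ S :=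
    eventually_mem_nhdsWithin.mono fun s hs => hs.1
  have hslope : (fun s => ∫ x, (s - t)⁻¹ • (F s x - F t x) ∂μ) =ᶠ[𝓝[S \ {t}] t]
      slope (fun s => ∫ x, F s x ∂μ) t := by
    filter_upwards [hmem] with s hs
    rw [slope_def_module, integral_smul, integral_sub (hF_int s hs) (hF_int t ht)]
  refine Tendsto.congr' hslope ?_
  refine tendsto_integral_filter_of_dominated_convergence bound ?_ ?_ hbound_int ?_
  · filter_upwards [hmem] with s hs
    exact (((hF_int s hs).sub (hF_int t ht)).smul (s - t)⁻¹).aestronglyMeasurable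
  · -- uniform bound on the difference quotients via the mean value inequality on `S`
    filter_upwards [hmem] with s hs
    refine Eventually.of_forall fun x => ?_
    have hMVT := hS.norm_image_sub_le_of_norm_hasDerivWithin_le
      (f := (F · x)) (f' := fun τ => F' τ x) (fun τ hτ => hderiv τ hτ x)
      (fun τ hτ => hbound τ hτ x) ht hs
    rcases eq_or_ne s t with rfl | hst
    · simpa using (norm_nonneg _).trans (hbound s hs x)
    · rw [norm_smul, norm_inv, ← div_eq_inv_mul, div_le_iff₀ (norm_pos_iff.2 (sub_ne_zero.2 hst))]
      simpa [Real.norm_eq_abs] using hMVT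
  · refine Eventually.of_forall fun x => ?_
    have h := hasDerivWithinAt_iff_tendsto_slope.1 (hderiv t ht x)
    have hs : slope (fun s => F s x) t = fun s => (s - t)⁻¹ • (F s x - F t x) :=
      funext fun s => slope_def_module _ _ _
    rwa [hs] at h

/-! ## Uniform bounds for jointly smooth space–time fields on a compact time set -/

section SpaceTime

variable {d : Type*} [Fintype d]
variable {F : Type*} [NormedAddCommGroup F] [NormedSpace ℝ F]

/-- A jointly smooth space–time field on a compact time set is uniformly bounded on `S × 𝕋ᵈ`
(continuity of the lift on the compact `S × [0,1]ᵈ`). [folklore] -/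
theorem exists_forall_norm_le_of_isSmoothSpaceTimeOn {S : Set ℝ} (hSc : IsCompact S)
    {φ : ℝ → UnitAddTorus d → F} (hφ : Torus.IsSmoothSpaceTimeOn S φ) :
    ∃ C : ℝ, 0 < C ∧ ∀ s ∈ S, ∀ x, ‖φ s x‖ ≤ C := by
  have hcont : ContinuousOn (Torus.stLift φ) (S ×ˢ univ) := hφ.continuousOn
  obtain ⟨C, hC⟩ := (hSc.prod Torus.isCompact_toLp_image_pi_Icc).exists_bound_of_continuousOn
    (hcont.mono (prod_mono le_rfl (subset_univ _)))
  refine ⟨max C 1, lt_max_of_lt_right one_pos, fun s hs x => ?_⟩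
  have h := hC (s, Torus.repr x) (mk_mem_prod hs (Torus.repr_mem_toLp_image_pi_Icc x))
  rw [Torus.stLift_apply, Torus.proj_repr] at h
  exact h.trans (le_max_left _ _)

/-- The one-sided time derivative of a jointly smooth space–time field on a compact time set of
unique differentiability is uniformly bounded on `S × 𝕋ᵈ` (continuity of `fderivWithin` of the
lift on the compact `S × [0,1]ᵈ`). [folklore] -/
theorem exists_forall_norm_timeDerivWithin_le {S : Set ℝ} (hSc : IsCompact S)
    (hS : UniqueDiffOn ℝ S) {φ : ℝ → UnitAddTorus d → F} (hφ : Torus.IsSmoothSpaceTimeOn S φ) :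
    ∃ C : ℝ, 0 < C ∧ ∀ s ∈ S, ∀ x, ‖Torus.timeDerivWithin S φ s x‖ ≤ C := by
  have hU : UniqueDiffOn ℝ (S ×ˢ (univ : Set (EuclideanSpace ℝ d))) := hS.prod uniqueDiffOn_univ
  have hGc : ContinuousOn (fun z => fderivWithin ℝ (Torus.stLift φ) (S ×ˢ univ) z (1, 0))
      (S ×ˢ (univ : Set (EuclideanSpace ℝ d))) :=
    (hφ.continuousOn_fderivWithin hU (by simp)).clm_apply continuousOn_const
  obtain ⟨C, hC⟩ := (hSc.prod Torus.isCompact_toLp_image_pi_Icc).exists_bound_of_continuousOn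
    (hGc.mono (prod_mono le_rfl (subset_univ _)))
  refine ⟨max C 1, lt_max_of_lt_right one_pos, fun s hs x => ?_⟩
  have h := hC (s, Torus.repr x) (mk_mem_prod hs (Torus.repr_mem_toLp_image_pi_Icc x))
  rw [← hφ.timeDerivWithin_apply_proj hS hs, Torus.proj_repr] at h
  exact h.trans (le_max_left _ _)

/-- The one-sided time derivative `s ↦ ∂ₜφ(s, x)` of a jointly smooth space–time field is
continuous on a time set of unique differentiability, for every `x`. [folklore] -/
theorem continuousOn_timeDerivWithin_of_isSmoothSpaceTimeOn {S : Set ℝ} (hS : UniqueDiffOn ℝ S)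
    {φ : ℝ → UnitAddTorus d → F} (hφ : Torus.IsSmoothSpaceTimeOn S φ) (x : UnitAddTorus d) :
    ContinuousOn (fun s => Torus.timeDerivWithin S φ s x) S := by
  have hU : UniqueDiffOn ℝ (S ×ˢ (univ : Set (EuclideanSpace ℝ d))) := hS.prod uniqueDiffOn_univ
  have hGc : ContinuousOn (fun z => fderivWithin ℝ (Torus.stLift φ) (S ×ˢ univ) z (1, 0))
      (S ×ˢ (univ : Set (EuclideanSpace ℝ d))) :=
    (hφ.continuousOn_fderivWithin hU (by simp)).clm_apply continuousOn_const
  have hcomp : ContinuousOn (fun s => fderivWithin ℝ (Torus.stLift φ) (S ×ˢ univ)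
      (s, Torus.repr x) (1, 0)) S :=
    hGc.comp (continuousOn_id.prodMk continuousOn_const) fun s hs => mk_mem_prod hs (mem_univ _)
  refine hcomp.congr fun s hs => ?_
  show Torus.timeDerivWithin S φ s x = fderivWithin ℝ (Torus.stLift φ) (S ×ˢ univ) (s, Torus.repr x) (1, 0)
  rw [← hφ.timeDerivWithin_apply_proj hS hs, Torus.proj_repr]

/-- The time slices `s ↦ φ(s, x)` of a jointly smooth space–time field are continuous on the time
set, for every `x`. [folklore] -/
theorem continuousOn_apply_of_isSmoothSpaceTimeOn {S : Set ℝ} {φ : ℝ → UnitAddTorus d → F}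
    (hφ : Torus.IsSmoothSpaceTimeOn S φ) (x : UnitAddTorus d) :
    ContinuousOn (fun s => φ s x) S :=
  fun _ hs => (hφ.hasDerivWithinAt_slice hs x).continuousWithinAt

/-- Reciprocal bound: for `0 < φ ≤ C`, `(2 C)⁻¹ ≤ (2 φ)⁻¹`. [folklore] -/
theorem inv_two_mul_ge {φ C : ℝ} (hφ : 0 < φ) (hle : φ ≤ C) : (2 * C)⁻¹ ≤ (2 * φ)⁻¹ :=
  inv_anti₀ (mul_pos two_pos hφ) (by linarith)

end SpaceTime

end StubLedger

/-- Registered sub-goal `stub_ledger_calculus` of the stub `stub_ledger`: dominated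
differentiation under the integral sign within a convex time set, real integrands
(`StubLedger.hasDerivWithinAt_integral_of_dominated_convex`). [folklore] -/
theorem stub_ledger_calculus : ∀ {X : Type} [MeasurableSpace X] (μ : Measure X) {S : Set ℝ}, Convex ℝ S → ∀ {t : ℝ}, t ∈ S → ∀ {F F' : ℝ → X → ℝ} {bound : X → ℝ}, (∀ s ∈ S, Integrable (F s) μ) → (∀ s ∈ S, ∀ x, HasDerivWithinAt (F · x) (F' s x) S s) → (∀ s ∈ S, ∀ x, ‖F' s x‖ ≤ bound x) → Integrable bound μ → AEStronglyMeasurable (F' t) μ → HasDerivWithinAt (fun s => ∫ x, F s x ∂μ) (∫ x, F' t x ∂μ) S t :=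
  fun _ _ hS _ ht _ _ _ hF hd hb hbi hm =>
    StubLedger.hasDerivWithinAt_integral_of_dominated_convex hS ht hF hd hb hbi hm

end Summit.AtomisticToContinuum.HydrodynamicLimit.Theorems.MacroClosureLine

end
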